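import Mathlib
import Literature.MathematicalPhysics.QuantumFieldTheory.Balaban1983to89.B6CoverBox
import Literature.MathematicalPhysics.QuantumFieldTheory.Balaban1983to89.B6Lemma21TowerTorus

/-!
# `Balaban1983to89.B6CoverTorus` — T. Bałaban, *Propagators and renormalization transformations for lattice gauge theories. II*,
Commun. Math. Phys. **96** (1984) 223–250 [Balaban1984PropagatorsII]: **the cube cover 𝒟 and the partition of unity {h_□} of (2.36),
IN COORDINATES ON THE ONE-SCALE TOWER TORUS `T^{(j)} = Site P j`** (periodic twin of the box model `…B6CoverBox`; the profile `h` of [B5] =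
*Propagators … I*, Commun. Math. Phys. **95** (1984) 17–40 [Balaban1984PropagatorsI], (1.118))

statement-level skeleton of published theorems with citation tags; proofs where landed; nothing here is a claim about the Yang–Mills mass gap

Phase-2 PROOF SEAT p01 (gen 7) of the cell `lit-balaban` (HOME `run/shared/lean/pub/lit-balaban/`), free-target protocol G.5-34(d), own lane
(the one-scale tower-torus lineage `…B6Prop22OneScaleTorus` → `…B6Lemma21TowerTorus` → `…B6Ineq268OneScaleTorus` → `…B6QGGQInvTowerTorus` →
`…B6QGQCoerciveTowerTorus` → `…B6Ineq288OneScaleTorus`).  This file is the COVER half of the genuine one-scale instance of Proposition 2.3's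
random-walk construction (2.70)/(2.82)/(2.85)/(2.86) (sibling `…B6Expansion286TowerTorus`).  Sources read as page images:
`run/shared/lean/pub/pub-balaban/b2b-balaban-ref1/pages/1984-cmp96-propagators-rt-II/1984-cmp96-propagators-rt-II-p007-x2.png` (p. 229),
`…-p013-x2.png` (p. 235), `…-p015-x2.png` (p. 237); journal page = PDF page + 222.

THE PRINTED TEXT.  p. 229 [PDF 7]: *"Each set Λ_j is a sum of big blocks of the size ML^jη (Λ_j ⊂ T^{(j)}_{L^jη}), or of the size M if Λ_j is
scaled to unit lattice. We cover B^j(Λ_j) by a sum of cubes □ of the size 2ML^jη, each cube being a sum of 2^d big blocks with a center y ∈ Λ_j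
(more exactly it belongs to the boundary of this set also). … We construct also the corresponding family of functions h described in (1.118),
and rescale them to proper scales. They satisfy Σ_{□∈𝒟} h_□² = 1. (2.36)"*  [B5] p. 36 [PDF 20]: *"h_z(x) = Π_{μ=1}^d h((x_μ − z_μ)∕M₀),
h ∈ C₀^∞(]−⅔, ⅔[), h(t) = 1 for t ∈ [−⅓, ⅓], h is chosen in such a way that Σ_n h²(t − n) = 1, hence Σ_z h_z²(x) = 1. (1.118)"*  p. 235
[PDF 13]: *"If we have one scale, i.e. Λ_k = T₁^{(k)}, then the operator is a unit lattice operator."*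

WHAT THIS FILE PROVES (kernel-checked, 0 sorry, axioms standard).  On the torus `T^{(j)} = Site P j = (ℤ/N_jℤ)^d`, `N_j = 2L^{m+K−j}`, with
cube size `M ≥ 1`, `M ∣ N_j`, `2M ≤ N_j` (so that the M-grid of centres `(Mℤ/N_jℤ)^d ≅ (ℤ/qℤ)^d`, `q = N_j/M ≥ 2`, closes up periodically):
* §1 circle arithmetic (`sum_prof_sq_circle`, `card_near_le_two`): for `v ∈ ℤ/qMℤ` only the two nearest centres `⌊v/M⌋M`, `(⌊v/M⌋+1 mod q)M`
  are closer than `M`, at circular distances `r`, `M − r`; hence the periodised window identity `Σ_{j∈ℤ/q} h(dist(v − jM)/M)² = h(ρ)² +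
  h(ρ − 1)² = 1` (`B6CoverBox.prof_sq_add_prof_sq`; h is even) and at most two centres satisfy `3·dist < 2M`.
* §2 the cover: centres `ctr k = (k_μM)_μ`, `h_k(y) = Π_μ h(dist(y_μ − k_μM, N_jℤ)/M)` (`hcov`, profile `B6CoverBox.prof`), the 2M-cube
  `□_k = {dist(y_μ − k_μM) ≤ M ∀μ}` (`InCube`, indicator `cubeInd`), and the binders of the census certificate `B6Prop23Assembled.prop23_assembled`
  DISCHARGED: `hpf01` (`cubeInd_zero_or_one`), `hph` (`cubeInd_mul_hcov`), **(2.36) `h236` (`sum_hcov_sq`)**, the overlap number n₀ = 2^d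
  (`card_filter_hcov_ne_zero_le`), the Lipschitz bound `|h_k(y) − h_k(y″)| ≤ (3π∕2)/M·|y − y″|₁` (`abs_hcov_sub_le`, for the one-scale distance
  `T1` = periodic ℓ¹ distance of `…B6Prop22OneScaleTorus`), the gap `|y − y″|₁ ≥ M∕3` between □ᶜ and supp h_□ (`gap_of_cubeInd_eq_zero`),
  and the admissible cube sizes (`cover_hyps_one`, `cover_hyps_pow`: `M = L^{m′}`, `m′ + 1 ≤ m + K − j`).

HONEST SCOPE ∕ NOT CLAIMED.  One scale (the torus `T^{(j)}`, every site at scale j); the profile `h` is `B6CoverBox`'s explicit LIPSCHITZ `cos`-ramp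
(not C₀^∞ — only the Lipschitz bound is consumed downstream, as in the cell's certificate); the cube centres are the corner points `(k_μM)_μ` of
big blocks of the `Site` labelling (corner-anchored, as the tower's blocks `B1RG242Torus`); `□` is the closed 2M-cube (`2M + 1` sites per side).
No operator appears in this file.  Value = bookkeeping infrastructure for the sibling's genuine instance; NOT summit progress.
-/

namespace Literature.MathematicalPhysics.QuantumFieldTheory.Balaban1983to89.B6CoverTorus

open Finset
open B4TorusKernel.MultiPeriod (circAbs circAbs_nonneg circAbs_add_mul abs_add_mul_centre circAbs_of_centred centre)
open B6CoverBox (prof prof_nonneg prof_le_one prof_of_abs_le prof_of_le_abs abs_lt_of_prof_ne_zero abs_prof_sub_le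
  prof_sq_add_prof_sq abs_prod_sub_prod_le)

noncomputable section

/-! ## §1  Circle arithmetic: ℤ/Nℤ with N = qM, the centres jM, the two nearest centres of a point -/

section Circle

variable {N M q : ℕ}

/-- the lower nearest centre index `⌊v/M⌋` of `v ∈ [0, N)` is `< q`. [folklore] -/
private theorem div_lt_of_lt (hN : N = q * M) {v : ℕ} (hv : v < N) : v / M < q := by
  rcases Nat.eq_zero_or_pos M with hM | hM
  · subst hM
    simp at hN
    omega
  · rw [hN, mul_comm] at hv
    exact Nat.div_lt_of_lt_mul hv

/-- the two nearest centre indices `j₀`, `(j₀ + 1) mod q` are distinct (`q ≥ 2`). [folklore] -/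
private theorem ne_next_mod (hq : 2 ≤ q) {j₀ : ℕ} (hj₀ : j₀ < q) : j₀ ≠ (j₀ + 1) % q := by
  rcases Nat.lt_or_ge (j₀ + 1) q with hlt | hge
  · rw [Nat.mod_eq_of_lt hlt]
    omega
  · have hjq : j₀ + 1 = q := le_antisymm (by omega) hge
    rw [hjq, Nat.mod_self]
    omega

/-- distance to the lower nearest centre: `dist((j₀M + r) − j₀M, Nℤ) = r` for `r < M` (`q ≥ 2`). [folklore] -/
private theorem circAbs_sub_self_centre (hN : N = q * M) (hq : 2 ≤ q) {j₀ r : ℕ} (hr : r < M) :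
    circAbs N (((j₀ * M + r : ℕ) : ℤ) - ((j₀ * M : ℕ) : ℤ)) = (r : ℤ) := by
  have hN1 : 1 ≤ N := by rw [hN]; nlinarith
  have e : ((j₀ * M + r : ℕ) : ℤ) - ((j₀ * M : ℕ) : ℤ) = (r : ℤ) := by push_cast; ring
  have h2 : 2 * r ≤ N := by rw [hN]; nlinarith
  rw [e, circAbs_of_centred hN1 (by rw [abs_of_nonneg (by positivity)]; exact_mod_cast h2),
    abs_of_nonneg (by positivity)]

/-- distance to the upper nearest centre: `dist((j₀M + r) − ((j₀ + 1) mod q)M, Nℤ) = M − r` (`q ≥ 2`, `r < M`; the index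
wraps around at `j₀ = q − 1`). [folklore] -/
private theorem circAbs_sub_next_centre (hN : N = q * M) (hq : 2 ≤ q) {j₀ r : ℕ} (hj₀ : j₀ < q) (hr : r < M) :
    circAbs N (((j₀ * M + r : ℕ) : ℤ) - (((j₀ + 1) % q * M : ℕ) : ℤ)) = (M : ℤ) - (r : ℤ) := by
  have hN1 : 1 ≤ N := by rw [hN]; nlinarith
  have h2M : 2 * M ≤ N := by rw [hN]; nlinarith
  have hcen : 2 * |(r : ℤ) - (M : ℤ)| ≤ N := by
    rw [abs_of_nonpos (by omega)]
    have : ((2 * M : ℕ) : ℤ) ≤ (N : ℤ) := by exact_mod_cast h2M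
    push_cast at this
    linarith
  rcases Nat.lt_or_ge (j₀ + 1) q with hlt | hge
  · rw [Nat.mod_eq_of_lt hlt]
    have e : ((j₀ * M + r : ℕ) : ℤ) - (((j₀ + 1) * M : ℕ) : ℤ) = (r : ℤ) - (M : ℤ) := by push_cast; ring
    rw [e, circAbs_of_centred hN1 hcen, abs_of_nonpos (by omega)]
    ring
  · have hjq : j₀ + 1 = q := le_antisymm (by omega) hge
    rw [hjq, Nat.mod_self, zero_mul, Nat.cast_zero, sub_zero]
    have e : ((j₀ * M + r : ℕ) : ℤ) = ((r : ℤ) - (M : ℤ)) + (N : ℤ) * 1 := by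
      rw [hN, ← hjq]; push_cast; ring
    rw [e, circAbs_add_mul, circAbs_of_centred hN1 hcen, abs_of_nonpos (by omega)]
    ring

/-- every other centre is at circular distance `≥ M`: for `j < q` with `j ≠ j₀`, `j ≠ (j₀ + 1) mod q`,
`dist((j₀M + r) − jM, Nℤ) ≥ M`. [folklore] -/
private theorem le_circAbs_sub_other_centre (hN : N = q * M) (hM : 1 ≤ M) {j₀ r j : ℕ} (hj₀ : j₀ < q) (hr : r < M)
    (hjq : j < q) (h0 : j ≠ j₀) (h1 : j ≠ (j₀ + 1) % q) :
    (M : ℤ) ≤ circAbs N (((j₀ * M + r : ℕ) : ℤ) - ((j * M : ℕ) : ℤ)) := by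
  have hN1 : 1 ≤ N := by rw [hN]; nlinarith
  rw [← abs_add_mul_centre hN1]
  set c : ℤ := centre N (((j₀ * M + r : ℕ) : ℤ) - ((j * M : ℕ) : ℤ)) with hc
  set m : ℤ := (j₀ : ℤ) - (j : ℤ) + (q : ℤ) * c with hm
  have e : ((j₀ * M + r : ℕ) : ℤ) - ((j * M : ℕ) : ℤ) + (N : ℤ) * c = m * (M : ℤ) + (r : ℤ) := by
    rw [hm, hN]; push_cast; ring
  rw [e]
  have hr0 : (0 : ℤ) ≤ (r : ℤ) := by positivity
  have hrM : (r : ℤ) < M := by exact_mod_cast hr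
  have hM0 : (0 : ℤ) < M := by exact_mod_cast hM
  by_cases hm1 : 1 ≤ m
  · rw [abs_of_nonneg (by nlinarith)]
    nlinarith
  by_cases hm2 : m ≤ -2
  · rw [abs_of_neg (by nlinarith)]
    nlinarith
  exfalso
  have hjz : (0 : ℤ) ≤ j := by positivity
  have hjq' : (j : ℤ) < q := by exact_mod_cast hjq
  have hj0z : (0 : ℤ) ≤ (j₀ : ℤ) := by positivity
  have hj0q : (j₀ : ℤ) < q := by exact_mod_cast hj₀
  rcases (show m = 0 ∨ m = -1 by omega) with h | h
  · -- q·c = j − j₀ forces c = 0, j = j₀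
    have hqc : (q : ℤ) * c = (j : ℤ) - (j₀ : ℤ) := by rw [hm] at h; linarith
    rcases lt_trichotomy c 0 with hc0 | hc0 | hc0
    · have : (q : ℤ) * c ≤ -(q : ℤ) := by nlinarith
      linarith
    · rw [hc0, mul_zero] at hqc
      exact h0 (by exact_mod_cast (show (j : ℤ) = (j₀ : ℤ) by linarith))
    · have : (q : ℤ) ≤ (q : ℤ) * c := by nlinarith
      linarith
  · -- q·c = j − j₀ − 1 forces c = 0 (j = j₀ + 1 < q) or c = −1 (j = 0, j₀ = q − 1)
    have hqc : (q : ℤ) * c = (j : ℤ) - (j₀ : ℤ) - 1 := by rw [hm] at h; linarith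
    rcases lt_trichotomy c (-1) with hc0 | hc0 | hc0
    · have : (q : ℤ) * c ≤ -2 * (q : ℤ) := by nlinarith
      linarith
    · rw [hc0] at hqc
      have hjq2 : j₀ + 1 = q := by omega
      have hj00 : j = 0 := by omega
      apply h1
      rw [hjq2, Nat.mod_self, hj00]
    · rcases (show c = 0 ∨ 1 ≤ c by omega) with hc1 | hc1
      · rw [hc1, mul_zero] at hqc
        have hjj : j = j₀ + 1 := by omega
        apply h1
        rw [← hjj, Nat.mod_eq_of_lt hjq]
      · have : (q : ℤ) ≤ (q : ℤ) * c := by nlinarith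
        linarith

/-- every `v < N = qM` is `j₀M + r` with `j₀ < q`, `r < M`. [folklore] -/
private theorem exists_floor_rem (hN : N = q * M) (hM : 1 ≤ M) {v : ℕ} (hv : v < N) :
    ∃ j₀ r : ℕ, j₀ < q ∧ r < M ∧ v = j₀ * M + r :=
  ⟨v / M, v % M, div_lt_of_lt hN hv, Nat.mod_lt v hM, (Nat.div_add_mod' v M).symm⟩

/-- **The one-dimensional partition identity on the circle**: for `N = qM`, `q ≥ 2`, `M ≥ 1` and every `v ∈ [0, N)`,
`Σ_{j<q} h(dist(v − jM, Nℤ)/M)² = 1` — only the two nearest centres contribute, with `h(ρ)² + h(ρ − 1)² = 1`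
(`B6CoverBox.prof_sq_add_prof_sq`; h is even); printed *"h is chosen in such a way that Σ_n h²(t − n) = 1"*.
[cite: Balaban1984PropagatorsI, (1.118) p.36] -/
theorem sum_prof_sq_circle (hN : N = q * M) (hq : 2 ≤ q) (hM : 1 ≤ M) {v : ℕ} (hv : v < N) :
    ∑ j : Fin q, prof (((circAbs N ((v : ℤ) - (((j : ℕ) * M : ℕ) : ℤ)) : ℤ) : ℝ) / M) ^ 2 = 1 := by
  obtain ⟨j₀, r, hj₀, hr, hv'⟩ := exists_floor_rem hN hM hv
  subst hv'
  have hj1 : (j₀ + 1) % q < q := Nat.mod_lt _ (by omega)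
  have hM0 : (0 : ℝ) < M := by exact_mod_cast hM
  rw [Fintype.sum_eq_add (⟨j₀, hj₀⟩ : Fin q) ⟨(j₀ + 1) % q, hj1⟩
    (fun h => ne_next_mod hq hj₀ (congrArg Fin.val h)) ?_]
  · simp only []
    rw [circAbs_sub_self_centre hN hq hr, circAbs_sub_next_centre hN hq hj₀ hr]
    set ρ : ℝ := (r : ℝ) / M with hρdef
    have hρ0 : 0 ≤ ρ := by positivity
    have hρ1 : ρ ≤ 1 := by
      rw [hρdef, div_le_one hM0]
      exact_mod_cast hr.le
    have e1 : (((r : ℤ)) : ℝ) / (M : ℝ) = ρ := by rw [hρdef, Int.cast_natCast]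
    have e2 : (((M : ℤ) - (r : ℤ) : ℤ) : ℝ) / (M : ℝ) = -(ρ - 1) := by
      rw [hρdef, Int.cast_sub, Int.cast_natCast, Int.cast_natCast]
      field_simp
      ring
    rw [e1, e2, show prof (-(ρ - 1)) = prof (ρ - 1) by unfold prof B6CoverBox.ramp; rw [abs_neg]]
    exact prof_sq_add_prof_sq hρ0 hρ1
  · intro k hk
    have hk0 : (k : ℕ) ≠ j₀ := fun h => hk.1 (Fin.ext h)
    have hk1 : (k : ℕ) ≠ (j₀ + 1) % q := fun h => hk.2 (Fin.ext h)
    have hle := le_circAbs_sub_other_centre hN hM hj₀ hr k.isLt hk0 hk1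
    have hle' : (M : ℝ) ≤ ((circAbs N (((j₀ * M + r : ℕ) : ℤ) - (((k : ℕ) * M : ℕ) : ℤ)) : ℤ) : ℝ) := by
      exact_mod_cast hle
    rw [prof_of_le_abs, zero_pow two_ne_zero]
    rw [abs_of_nonneg (div_nonneg (le_trans hM0.le hle') hM0.le), le_div_iff₀ hM0]
    linarith

/-- the centres close to a point are among the two nearest: for `v = j₀M + r`, `3·dist(v − jM, Nℤ) < 2M` forces
`j ∈ {j₀, (j₀+1) mod q}`. [folklore] -/
private theorem near_subset_pair (hN : N = q * M) (hq : 2 ≤ q) (hM : 1 ≤ M) {j₀ r : ℕ} (hj₀ : j₀ < q) (hr : r < M) :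
    (Finset.univ.filter fun j : Fin q =>
        3 * circAbs N (((j₀ * M + r : ℕ) : ℤ) - (((j : ℕ) * M : ℕ) : ℤ)) < 2 * M) ⊆
      {⟨j₀, hj₀⟩, ⟨(j₀ + 1) % q, Nat.mod_lt _ (by omega)⟩} := by
  intro k hk
  rw [Finset.mem_filter] at hk
  rw [Finset.mem_insert, Finset.mem_singleton]
  by_contra hne
  rw [not_or] at hne
  have hk0 : (k : ℕ) ≠ j₀ := fun h => hne.1 (Fin.ext h)
  have hk1 : (k : ℕ) ≠ (j₀ + 1) % q := fun h => hne.2 (Fin.ext h)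
  have hle := le_circAbs_sub_other_centre hN hM hj₀ hr k.isLt hk0 hk1
  linarith [hk.2]

/-- … hence at most two centres are close to any point: `#{j ∈ ℤ/q : 3·dist(v − jM, Nℤ) < 2M} ≤ 2` (p. 229: the 2M-cubes on the
M-lattice overlap 2^d-fold, *"each cube being a sum of 2^d big blocks"*). [cite: Balaban1984PropagatorsII, p.229 before (2.36)] -/
theorem card_near_le_two (hN : N = q * M) (hq : 2 ≤ q) (hM : 1 ≤ M) {v : ℕ} (hv : v < N) :
    (Finset.univ.filter fun j : Fin q =>
        3 * circAbs N ((v : ℤ) - (((j : ℕ) * M : ℕ) : ℤ)) < 2 * M).card ≤ 2 := by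
  obtain ⟨j₀, r, hj₀, hr, hv'⟩ := exists_floor_rem hN hM hv
  subst hv'
  exact (Finset.card_le_card (near_subset_pair hN hq hM hj₀ hr)).trans Finset.card_le_two

end Circle

/-! ## §2  The periodic cube cover 𝒟 of `T^{(j)} = Site P j`: centres on the M-grid, h_□, □ -/

section Cover

open B4Sect5Torus (ccoord ccoord_cast ccoord_triangle ccoord_symm ccoord_self)
open B5Ineq137Torus (toT Nv Nv_pos)
open B6Prop22OneScaleTorus (T1)

variable (P : Params) (j Mb : ℕ)

/-- The number `q = N_j/M` of cube centres per direction on the torus `T^{(j)}` with `N_j = 2L^{m+K−j}` sites per direction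
(the centres lie on the M-lattice of big blocks, p. 229). [cite: Balaban1984PropagatorsII, p.229 before (2.36)] -/
def nC : ℕ := P.sitesPerDir j / Mb

/-- The index set 𝒟 of the cubes: one cube per point of the M-grid `(Mℤ/N_jℤ)^d ≅ (ℤ/qℤ)^d`. [cite: Balaban1984PropagatorsII, p.229 before (2.36)] -/
abbrev CIdx : Type := Fin P.d → Fin (nC P j Mb)

/-- The centre `(k_μM)_μ ∈ T^{(j)}` of the cube with index `k` (p. 229: *"with a center y ∈ Λ_j (more exactly it belongs to the
boundary of this set also)"* — a corner point of big blocks). [cite: Balaban1984PropagatorsII, p.229 before (2.36)] -/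
def ctr (k : CIdx P j Mb) : Site P j := fun μ => ((((k μ : ℕ) * Mb : ℕ) : ℕ) : ZMod (P.sitesPerDir j))

/-- The circular coordinate distance `dist(y_μ − c_μ, N_jℤ)` of two sites of `T^{(j)}` (a summand of `|y − c|₁ = T1`).
[cite: Balaban1984PropagatorsII, (2.46) p.231; bookkeeping] -/
def cd (y c : Site P j) (μ : Fin P.d) : ℕ := ccoord (Nv P j) (toT y) (toT c) μ

/-- **h_□ on the torus**: `h_k(y) = Π_μ h(dist(y_μ − k_μM, N_jℤ)/M)` with the explicit profile `h = B6CoverBox.prof` of [B5] (1.118)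
(periodised: the printed `h((x_μ − z_μ)/M₀)` with the torus representative of `x_μ − z_μ`; `h` is even).
[cite: Balaban1984PropagatorsI, (1.118) p.36; Balaban1984PropagatorsII, (2.36) p.229] -/
def hcov (k : CIdx P j Mb) (y : Site P j) : ℝ := ∏ μ, prof (((cd P j y (ctr P j Mb k) μ : ℕ) : ℝ) / Mb)

/-- `y ∈ □_k`, the cube *"of the size 2M"* (2^d big blocks) about the centre: `dist(y_μ − k_μM, N_jℤ) ≤ M` for every μ.
[cite: Balaban1984PropagatorsII, p.229 before (2.36)] -/
def InCube (k : CIdx P j Mb) (y : Site P j) : Prop := ∀ μ, cd P j y (ctr P j Mb k) μ ≤ Mb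

/-- membership in □_k is decidable (finitely many coordinate comparisons). [cite: Balaban1984PropagatorsII, p.229 before (2.36); bookkeeping] -/
instance instDecidablePredInCube (k : CIdx P j Mb) : DecidablePred (InCube P j Mb k) :=
  fun y => by unfold InCube; infer_instance

open Classical in
/-- The indicator of □_k (the multiplication operator □ of (2.82), on which `(Q′G′²Q′*)↾□` and `C_□` live).
[cite: Balaban1984PropagatorsII, p.235 (2.70), p.237 (2.82)] -/
def cubeInd (k : CIdx P j Mb) (y : Site P j) : ℝ := if InCube P j Mb k y then 1 else 0

variable {P j Mb}

/-- the coordinate distance as an integer is `circAbs`. [folklore] -/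
private theorem cd_cast (y c : Site P j) (μ : Fin P.d) :
    ((cd P j y c μ : ℕ) : ℤ) = circAbs (P.sitesPerDir j) (((y μ).val : ℤ) - ((c μ).val : ℤ)) :=
  ccoord_cast (Nv_pos P j) (toT y) (toT c) μ

/-- `q·M ≤ N_j`. [folklore] -/
private theorem nC_mul_le : nC P j Mb * Mb ≤ P.sitesPerDir j := Nat.div_mul_le_self _ _

/-- the label of the centre coordinate `k_μM` is `k_μM` itself (no wrap-around: `k_μ < q`, `qM ≤ N_j`). [folklore] -/
private theorem ctr_val (hMb : 1 ≤ Mb) (k : CIdx P j Mb) (μ : Fin P.d) : ((ctr P j Mb k) μ).val = (k μ : ℕ) * Mb := by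
  have hlt : (k μ : ℕ) * Mb < P.sitesPerDir j := by
    have h1 : ((k μ : ℕ) + 1) * Mb ≤ nC P j Mb * Mb := Nat.mul_le_mul_right _ (k μ).isLt
    have h2 := nC_mul_le (P := P) (j := j) (Mb := Mb)
    nlinarith
  show ((((k μ : ℕ) * Mb : ℕ) : ZMod (P.sitesPerDir j))).val = (k μ : ℕ) * Mb
  rw [ZMod.val_natCast, Nat.mod_eq_of_lt hlt]

/-- the distance of `y` to the centre `k` in coordinate μ is `dist(y_μ − k_μM, N_jℤ)`. [folklore] -/
private theorem cd_ctr_cast (hMb : 1 ≤ Mb) (y : Site P j) (k : CIdx P j Mb) (μ : Fin P.d) :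
    ((cd P j y (ctr P j Mb k) μ : ℕ) : ℤ) = circAbs (P.sitesPerDir j) (((y μ).val : ℤ) - (((k μ : ℕ) * Mb : ℕ) : ℤ)) := by
  rw [cd_cast, ctr_val hMb]

/-- under `M ∣ N_j`: `N_j = qM`. [folklore] -/
private theorem sites_eq (hdiv : Mb ∣ P.sitesPerDir j) : P.sitesPerDir j = nC P j Mb * Mb := (Nat.div_mul_cancel hdiv).symm

/-- under `2M ≤ N_j`: `q ≥ 2`. [folklore] -/
private theorem two_le_nC (hMb : 1 ≤ Mb) (h2 : 2 * Mb ≤ P.sitesPerDir j) : 2 ≤ nC P j Mb :=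
  (Nat.le_div_iff_mul_le hMb).mpr h2

/-- `h_□ ≥ 0` (h takes values in [0, 1]). [cite: Balaban1984PropagatorsI, (1.118) p.36; bookkeeping] -/
theorem hcov_nonneg (k : CIdx P j Mb) (y : Site P j) : 0 ≤ hcov P j Mb k y :=
  Finset.prod_nonneg fun _ _ => prof_nonneg _

/-- `h_□ ≤ 1` (h takes values in [0, 1]). [cite: Balaban1984PropagatorsI, (1.118) p.36; bookkeeping] -/
theorem hcov_le_one (k : CIdx P j Mb) (y : Site P j) : hcov P j Mb k y ≤ 1 :=
  Finset.prod_le_one (fun _ _ => prof_nonneg _) fun _ _ => prof_le_one _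

/-- `|h_□| ≤ 1` (the binder `hh1` of the cell's chain lemmas). [cite: Balaban1984PropagatorsI, (1.118) p.36; bookkeeping] -/
theorem abs_hcov_le_one (k : CIdx P j Mb) (y : Site P j) : |hcov P j Mb k y| ≤ 1 := by
  rw [abs_of_nonneg (hcov_nonneg k y)]; exact hcov_le_one k y

/-- supp h_□ lies in the (4M∕3)-cube: `h_k(y) ≠ 0 ⟹ 3·dist(y_μ − k_μM, N_jℤ) < 2M` for every μ ([B5] (1.118): supp h ⊂ ]−⅔, ⅔[).
[cite: Balaban1984PropagatorsI, (1.118) p.36] -/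
theorem three_mul_cd_lt_of_hcov_ne_zero (hMb : 1 ≤ Mb) {k : CIdx P j Mb} {y : Site P j} (h : hcov P j Mb k y ≠ 0) (μ : Fin P.d) :
    3 * cd P j y (ctr P j Mb k) μ < 2 * Mb := by
  have hM0 : (0 : ℝ) < Mb := by exact_mod_cast hMb
  have hfac : prof (((cd P j y (ctr P j Mb k) μ : ℕ) : ℝ) / Mb) ≠ 0 :=
    fun h0 => h (Finset.prod_eq_zero (Finset.mem_univ μ) h0)
  have hlt := abs_lt_of_prof_ne_zero hfac
  rw [abs_of_nonneg (by positivity), div_lt_iff₀ hM0] at hlt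
  have : (3 : ℝ) * (cd P j y (ctr P j Mb k) μ : ℕ) < 2 * Mb := by linarith
  exact_mod_cast this

/-- supp h_□ ⊂ □ (the binder `hhsq` shape): `⅔M ≤ M`. [cite: Balaban1984PropagatorsII, p.229 (2.36)] -/
theorem inCube_of_hcov_ne_zero (hMb : 1 ≤ Mb) {k : CIdx P j Mb} {y : Site P j} (h : hcov P j Mb k y ≠ 0) :
    InCube P j Mb k y := by
  intro μ
  have := three_mul_cd_lt_of_hcov_ne_zero hMb h μ
  omega

/-- □ takes the values 0, 1 (the binder `hpf01`). [cite: Balaban1984PropagatorsII, (2.82) p.237; bookkeeping] -/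
theorem cubeInd_zero_or_one (k : CIdx P j Mb) (y : Site P j) : cubeInd P j Mb k y = 0 ∨ cubeInd P j Mb k y = 1 := by
  unfold cubeInd; split_ifs <;> simp

/-- □ = 1 on □. [cite: Balaban1984PropagatorsII, (2.82) p.237; bookkeeping] -/
theorem cubeInd_eq_one {k : CIdx P j Mb} {y : Site P j} (h : InCube P j Mb k y) : cubeInd P j Mb k y = 1 := by
  unfold cubeInd; rw [if_pos h]

/-- □ = 0 off □. [cite: Balaban1984PropagatorsII, (2.82) p.237; bookkeeping] -/
theorem cubeInd_eq_zero {k : CIdx P j Mb} {y : Site P j} (h : ¬ InCube P j Mb k y) : cubeInd P j Mb k y = 0 := by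
  unfold cubeInd; rw [if_neg h]

/-- supp □ ⊂ □. [cite: Balaban1984PropagatorsII, (2.82) p.237; bookkeeping] -/
theorem inCube_of_cubeInd_ne_zero {k : CIdx P j Mb} {y : Site P j} (h : cubeInd P j Mb k y ≠ 0) : InCube P j Mb k y := by
  by_contra hc; exact h (cubeInd_eq_zero hc)

/-- **□·h_□ = h_□** (the binder `hph`: h_□ is carried by its cube). [cite: Balaban1984PropagatorsII, p.229 (2.36), p.237 (2.82)] -/
theorem cubeInd_mul_hcov (hMb : 1 ≤ Mb) (k : CIdx P j Mb) (y : Site P j) :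
    cubeInd P j Mb k y * hcov P j Mb k y = hcov P j Mb k y := by
  by_cases h : hcov P j Mb k y = 0
  · rw [h, mul_zero]
  · rw [cubeInd_eq_one (inCube_of_hcov_ne_zero hMb h), one_mul]

/-- **(2.36) ON THE TORUS** (the binder `h236`): `Σ_{□∈𝒟} h_□(y)² = 1` at every site of `T^{(j)}` — the product structure turns
the sum over the centres `k ∈ (ℤ/qℤ)^d` into the product over μ of the circle identities `Σ_{j<q} h(dist(y_μ − jM, N_jℤ)/M)² = 1`
(`sum_prof_sq_circle`); hypotheses `M ≥ 1`, `M ∣ N_j`, `2M ≤ N_j`.  Printed: *"They satisfy Σ_{□∈𝒟} h_□² = 1. (2.36)"*.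
[cite: Balaban1984PropagatorsII, (2.36) p.229] -/
theorem sum_hcov_sq (hMb : 1 ≤ Mb) (hdiv : Mb ∣ P.sitesPerDir j) (h2 : 2 * Mb ≤ P.sitesPerDir j) (y : Site P j) :
    ∑ k : CIdx P j Mb, hcov P j Mb k y ^ 2 = 1 := by
  set F : (μ : Fin P.d) → Fin (nC P j Mb) → ℝ := fun μ i =>
    prof (((circAbs (P.sitesPerDir j) (((y μ).val : ℤ) - (((i : ℕ) * Mb : ℕ) : ℤ)) : ℤ) : ℝ) / Mb) ^ 2 with hF
  have hcoord : ∀ μ : Fin P.d, ∑ i : Fin (nC P j Mb), F μ i = 1 := fun μ =>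
    sum_prof_sq_circle (sites_eq hdiv) (two_le_nC hMb h2) hMb (ZMod.val_lt (y μ))
  have hfac : ∀ k : CIdx P j Mb, hcov P j Mb k y ^ 2 = ∏ μ, F μ (k μ) := by
    intro k
    rw [hcov, ← Finset.prod_pow]
    refine Finset.prod_congr rfl fun μ _ => ?_
    simp only [hF]
    rw [← Int.cast_natCast (R := ℝ) (cd P j y (ctr P j Mb k) μ), cd_ctr_cast hMb]
  calc ∑ k : CIdx P j Mb, hcov P j Mb k y ^ 2 = ∑ k : CIdx P j Mb, ∏ μ, F μ (k μ) :=
        Finset.sum_congr rfl fun k _ => hfac k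
    _ = ∏ μ, ∑ i : Fin (nC P j Mb), F μ i := (Fintype.prod_sum F).symm
    _ = 1 := Finset.prod_eq_one fun μ _ => hcoord μ

/-- **Finite overlap** (the binder `hover`, n₀ = 2^d): at every site at most `2^d` of the `h_□` are non-zero — `h_k(y) ≠ 0` forces
`3·dist(y_μ − k_μM, N_jℤ) < 2M` in each coordinate, which only the two nearest centres satisfy (`card_near_le_two`); the indices lie
in a product of sets of size ≤ 2 (p. 229: *"each cube being a sum of 2^d big blocks"*). [cite: Balaban1984PropagatorsII, p.229 before (2.36)] -/
theorem card_filter_hcov_ne_zero_le (hMb : 1 ≤ Mb) (hdiv : Mb ∣ P.sitesPerDir j) (h2 : 2 * Mb ≤ P.sitesPerDir j)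
    (y : Site P j) : (Finset.univ.filter fun k : CIdx P j Mb => hcov P j Mb k y ≠ 0).card ≤ 2 ^ P.d := by
  classical
  set T : Fin P.d → Finset (Fin (nC P j Mb)) := fun μ =>
    Finset.univ.filter fun i : Fin (nC P j Mb) =>
      3 * circAbs (P.sitesPerDir j) (((y μ).val : ℤ) - (((i : ℕ) * Mb : ℕ) : ℤ)) < 2 * Mb with hT
  have hsub : (Finset.univ.filter fun k : CIdx P j Mb => hcov P j Mb k y ≠ 0) ⊆ Fintype.piFinset T := by
    intro k hk
    rw [Finset.mem_filter] at hk
    rw [Fintype.mem_piFinset]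
    intro μ
    simp only [hT, Finset.mem_filter, Finset.mem_univ, true_and]
    have h3 := three_mul_cd_lt_of_hcov_ne_zero hMb hk.2 μ
    have h3' : (3 : ℤ) * ((cd P j y (ctr P j Mb k) μ : ℕ) : ℤ) < 2 * (Mb : ℤ) := by exact_mod_cast h3
    rwa [cd_ctr_cast hMb] at h3'
  have hTcard : ∀ μ, (T μ).card ≤ 2 := fun μ =>
    card_near_le_two (sites_eq hdiv) (two_le_nC hMb h2) hMb (ZMod.val_lt (y μ))
  calc (Finset.univ.filter fun k : CIdx P j Mb => hcov P j Mb k y ≠ 0).card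
      ≤ (Fintype.piFinset T).card := Finset.card_le_card hsub
    _ = ∏ μ, (T μ).card := Fintype.card_piFinset T
    _ ≤ 2 ^ (Finset.univ : Finset (Fin P.d)).card := Finset.prod_le_pow_card _ _ _ fun μ _ => hTcard μ
    _ = 2 ^ P.d := by rw [Finset.card_univ, Fintype.card_fin]

/-- the coordinate distances to a fixed centre are 1-Lipschitz for the coordinate distance (reverse triangle inequality on the
circle). [folklore] -/
private theorem abs_cd_sub_cd_le (y y'' c : Site P j) (μ : Fin P.d) :
    |((cd P j y c μ : ℕ) : ℝ) - ((cd P j y'' c μ : ℕ) : ℝ)| ≤ ((cd P j y y'' μ : ℕ) : ℝ) := by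
  have h1 : cd P j y c μ ≤ cd P j y y'' μ + cd P j y'' c μ := ccoord_triangle (Nv_pos P j) _ _ _ μ
  have h2 : cd P j y'' c μ ≤ cd P j y'' y μ + cd P j y c μ := ccoord_triangle (Nv_pos P j) _ _ _ μ
  have h3 : cd P j y'' y μ = cd P j y y'' μ := ccoord_symm (Nv_pos P j) _ _ μ
  rw [h3] at h2
  rw [abs_sub_le_iff]
  constructor
  · have : ((cd P j y c μ : ℕ) : ℝ) ≤ ((cd P j y y'' μ : ℕ) : ℝ) + ((cd P j y'' c μ : ℕ) : ℝ) := by exact_mod_cast h1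
    linarith
  · have : ((cd P j y'' c μ : ℕ) : ℝ) ≤ ((cd P j y y'' μ : ℕ) : ℝ) + ((cd P j y c μ : ℕ) : ℝ) := by exact_mod_cast h2
    linarith

/-- `|y − y″|₁ = Σ_μ dist(y_μ − y″_μ, N_jℤ)` (unfolding of `T1`). [folklore] -/
private theorem T1_eq_sum_cd (y y'' : Site P j) : T1 P j y y'' = ∑ μ, ((cd P j y y'' μ : ℕ) : ℝ) := by
  unfold T1 cd; push_cast; rfl

/-- **The Lipschitz bound of h_□ on the torus** (the binder `hLip`, s = 3π∕2): `|h_k(y) − h_k(y″)| ≤ (3π∕2)/M · |y − y″|₁` — the product of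
factors in [0, 1] is 1-Lipschitz in each factor (`B6CoverBox.abs_prod_sub_prod_le`), `h` is (3π∕2)-Lipschitz (`B6CoverBox.abs_prof_sub_le`),
and each coordinate distance to the centre is 1-Lipschitz for the circular coordinate distance. [cite: Balaban1984PropagatorsII, p.237 («the commutator … gives a factor O(M⁻¹)»); Balaban1984PropagatorsI, (1.118) p.36] -/
theorem abs_hcov_sub_le (hMb : 1 ≤ Mb) (k : CIdx P j Mb) (y y'' : Site P j) :
    |hcov P j Mb k y - hcov P j Mb k y''| ≤ 3 * Real.pi / 2 / Mb * T1 P j y y'' := by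
  have hM0 : (0 : ℝ) < Mb := by exact_mod_cast hMb
  unfold hcov
  refine (abs_prod_sub_prod_le Finset.univ (fun μ => ⟨prof_nonneg _, prof_le_one _⟩)
    (fun μ => ⟨prof_nonneg _, prof_le_one _⟩)).trans ?_
  rw [T1_eq_sum_cd, Finset.mul_sum]
  refine Finset.sum_le_sum fun μ _ => ?_
  refine (abs_prof_sub_le _ _).trans ?_
  rw [← sub_div, abs_div, abs_of_pos hM0]
  have h := abs_cd_sub_cd_le y y'' (ctr P j Mb k) μ
  have hπ : (0 : ℝ) < 3 * Real.pi / 2 := by positivity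
  calc 3 * Real.pi / 2 * (|((cd P j y (ctr P j Mb k) μ : ℕ) : ℝ) - ((cd P j y'' (ctr P j Mb k) μ : ℕ) : ℝ)| / Mb)
      ≤ 3 * Real.pi / 2 * (((cd P j y y'' μ : ℕ) : ℝ) / Mb) :=
        mul_le_mul_of_nonneg_left (div_le_div_of_nonneg_right h hM0.le) hπ.le
    _ = 3 * Real.pi / 2 / Mb * ((cd P j y y'' μ : ℕ) : ℝ) := by ring

/-- one coordinate distance is at most `|y − y″|₁`. [folklore] -/
private theorem cd_le_T1 (y y'' : Site P j) (μ : Fin P.d) : ((cd P j y y'' μ : ℕ) : ℝ) ≤ T1 P j y y'' := by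
  rw [T1_eq_sum_cd]
  exact Finset.single_le_sum (f := fun ν => ((cd P j y y'' ν : ℕ) : ℝ)) (fun _ _ => by positivity) (Finset.mem_univ μ)

/-- **The gap between □ᶜ and supp h_□** (the binder `hgap`, m_g = ⅓): `y ∉ □_k` and `h_k(y″) ≠ 0` give `|y − y″|₁ ≥ M∕3` — in some
coordinate `dist(y_μ − k_μM) > M` while `dist(y″_μ − k_μM) < ⅔M`. [cite: Balaban1984PropagatorsII, p.237 («the fact that y ∉ □̃′»)] -/
theorem gap_of_cubeInd_eq_zero (hMb : 1 ≤ Mb) {k : CIdx P j Mb} {y y'' : Site P j} (hy : cubeInd P j Mb k y = 0)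
    (hy'' : hcov P j Mb k y'' ≠ 0) : (Mb : ℝ) / 3 ≤ T1 P j y y'' := by
  have hnc : ¬ InCube P j Mb k y := fun h => by rw [cubeInd_eq_one h] at hy; exact one_ne_zero hy
  unfold InCube at hnc
  push Not at hnc
  obtain ⟨μ, hμ⟩ := hnc
  have h3 := three_mul_cd_lt_of_hcov_ne_zero hMb hy'' μ
  have htri : cd P j y (ctr P j Mb k) μ ≤ cd P j y y'' μ + cd P j y'' (ctr P j Mb k) μ :=
    ccoord_triangle (Nv_pos P j) _ _ _ μ
  have hge : Mb ≤ 3 * cd P j y y'' μ := by omega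
  have hge' : (Mb : ℝ) ≤ 3 * ((cd P j y y'' μ : ℕ) : ℝ) := by exact_mod_cast hge
  have := cd_le_T1 y y'' μ
  linarith

/-- **Non-vacuity of the cover hypotheses**: on every tower torus `T^{(j)}` (`N_j = 2L^{m+K−j} ≥ 2`) the choice `M = 1` satisfies
`M ≥ 1`, `M ∣ N_j`, `2M ≤ N_j`; large `M` are available on large tori (`M = L^{m′}` with `m′ + 1 ≤ m + K − j`).
[cite: Balaban1984PropagatorsII, p.229 before (2.36); bookkeeping] -/
theorem cover_hyps_one : 1 ≤ 1 ∧ (1 : ℕ) ∣ P.sitesPerDir j ∧ 2 * 1 ≤ P.sitesPerDir j :=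
  ⟨le_rfl, one_dvd _, by have := P.one_lt_sitesPerDir j; omega⟩

/-- large admissible cube sizes: `M = L^{m′}` with `m′ + 1 ≤ m + K − j` divides `N_j = 2L^{m+K−j}` and `2M ≤ N_j`.
[cite: Balaban1984PropagatorsII, p.229 before (2.36); bookkeeping] -/
theorem cover_hyps_pow {m' : ℕ} (hm' : m' + 1 ≤ P.m + P.K - j) :
    1 ≤ P.L ^ m' ∧ P.L ^ m' ∣ P.sitesPerDir j ∧ 2 * P.L ^ m' ≤ P.sitesPerDir j := by
  have hL := P.L_pos
  refine ⟨Nat.one_le_pow _ _ hL, ?_, ?_⟩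
  · show P.L ^ m' ∣ 2 * P.L ^ (P.m + P.K - j)
    exact Dvd.dvd.mul_left (pow_dvd_pow _ (by omega)) 2
  · show 2 * P.L ^ m' ≤ 2 * P.L ^ (P.m + P.K - j)
    exact Nat.mul_le_mul_left 2 (Nat.pow_le_pow_right hL (by omega))

end Cover

end

end Literature.MathematicalPhysics.QuantumFieldTheory.Balaban1983to89.B6CoverTorus
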